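import Literature.AlgebraicGeometry.Motives.FaltingsAbelianOfFinitenessIProofs
import HarnessLib

/-!
# Faltings 1983, §5 (Satz 3, Satz 4, Korollar 1) from Tate's lattice lemma ALONE

Pure-proof sibling (theorems only, no definition, no named fact — D-0026) of
`Literature.AlgebraicGeometry.Motives.FaltingsAbelianOfFinitenessIProofs`. That file records
Faltings' theorems over a number field (`faltings_tate_bijective A B ℓ`: the Tate map
`ℤ_ℓ ⊗ Hom_K(A, B) → Hom_{Γ_K}(T_ℓ A, T_ℓ B)` is bijective, G. Faltings, Invent. Math. 73 (1983), §5,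
Satz 4 / Korollar 1; `isSemisimpleRepresentation_rationalTateRep A ℓ`, Satz 3) **modulo Finiteness I
and nothing else**. Finiteness I enters that deduction at exactly one point: Tate's lattice lemma
`tateSubspaceRealization P ℓ` (`TateAbelianFiniteSteps` :405: every `Γ_K`-stable `ℚ_ℓ`-subspace
`W ⊆ V_ℓ P` is `u(V_ℓ P)` for some `u` in the `ℚ_ℓ`-span of the `V_ℓ φ`, `φ ∈ End_K(P)`) for
`P = A ⊞ A` (Satz 4, graph trick) resp. `P = (A ⊞ B) ⊞ (A ⊞ B)` (Korollar 1, "Theorem 4 applied to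
`A₁ × A₂`") resp. `P = A` (Satz 3), obtained there by
`tateSubspaceRealization_of_finitenessI_of_quotient_of_free` (`FaltingsAbelianProofs` :260). This file
RE-KEYS the same assembly on the lattice lemma itself, so that any route to
`tateSubspaceRealization` — Finiteness I (Milne, *Abelian Varieties* (2008), Ch. IV, Thm. 1.1 ⇒
Lemma 2.4), or the weaker ℓ-power-tower hypothesis of Tate 1966, §2 / Faltings §5 ¶1 (Satz 1 + Satz 2
along ONE `ℓ`-divisible group; `TateAbelianLatticeOfEllPowerTowerProofs`) — yields Faltings' §5 with
no further input:

* `surjective_faltingsTateMap_of_tateSubspaceRealization` — Satz 4, surjectivity half, for `End_K(A)`,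
  from the lattice lemma for the point `b.pt` of a biproduct bicone of `(A, A)` and the
  semisimplicity of `E_ℓ(A)` (graph commutation + Jacobson density
  `mem_rationalEndSpanAV_iff_of_tateSubspaceRealization`, integral form
  `exists_ne_zero_smul_mem_span_of_equivariant_of_tateSubspaceRealization`, `ℓ`-saturation
  `mem_span_range_tateModuleMap_of_smul_mem`, span criterion
  `surjective_faltingsTateMap_of_forall_mem_span` — all ★ `TateAbelianFiniteEndProofs` /
  `FaltingsAbelianProofs`); `T_ℓ A` finitely generated is the theorem
  `module_finite_tateModule_holds_of_charZero`.
* `faltings_tate_end_bijective_of_tateSubspaceRealization_of_facts` — Satz 4 from the lattice lemma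
  for `A ⊞ A`, semisimplicity of `E_ℓ(A)` and injectivity of the Tate map as hypotheses (any field of
  characteristic `0` in which the statement is read over a number field);
  `faltings_tate_end_bijective_of_tateSubspaceRealization` — **Satz 4 from the lattice lemma for
  `A ⊞ A` ALONE**: semisimplicity of `E_ℓ(A)` is the theorem
  `isSemisimpleRing_adjoin_rationalTateModuleMap_of_endAlgebra` over
  `finiteDimensional_endAlgebra_holds` and `isSemisimpleRing_endAlgebra_of_perfectField` (Poincaré,
  Mumford §19 Cor. 2 of Thm. 1, with Galois descent to the perfect field `K`), injectivity is
  `faltingsTateMap_injective_holds` (Mumford §19 Thm. 3, from the theorem of the cube).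
* `faltings_tate_bijective_of_tateSubspaceRealization` — **Korollar 1 from the lattice lemma for
  `(A ⊞ B) ⊞ (A ⊞ B)` ALONE** (Satz 4 for `A ⊞ B`, then the corner `Hom(A, B)` of `End(A ⊞ B)` by
  `faltings_tate_bijective_of_end_biprod`). This is the text of the second rung
  `stub_faltings_of_realization` of the line `Cruxes/HLiu418/Lines/faltings_isogeny.lean` on item
  stmt-HodgeConjecture-24832 (A-plan1, `A-plan/FALTINGS-SPEC.md` §5), up to binder order.
* `isSemisimpleRepresentation_rationalTateRep_of_tateSubspaceRealization_alone` — **Satz 3 from the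
  lattice lemma for `A` ALONE** (`isSemisimpleRepresentation_rationalTateRep_of_tateSubspaceRealization`
  of `FaltingsAbelianSemisimpleProofs` :130 with `hss` discharged as above).
* The re-keying loses nothing: the Finiteness-I assembly of `FaltingsAbelianOfFinitenessIProofs`
  :197 is `faltings_tate_bijective_of_tateSubspaceRealization A B ℓ
  (tateSubspaceRealization_of_finitenessI_of_quotient_of_free ℓ _ hfin (exists_quotient_isogeny_holds _ ℓ))`
  (same statement as the landed theorem, so not re-declared here — dedup).

## References

* [Faltings1983Endlichkeit] G. Faltings, *Endlichkeitssätze für abelsche Varietäten über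
  Zahlkörpern*, Invent. Math. 73 (1983), 349–366, §5: Satz 3, Satz 4, Korollar 1 (English:
  Cornell–Silverman (eds.), *Arithmetic Geometry* (1986), Ch. II, §5, Theorems 3–4, Corollary 1,
  pp. 17–18; held `book:cornellnd-arithmetic-geometry`, PDF pp. 89–90).
* [Tate1966Endomorphisms] J. Tate, *Endomorphisms of abelian varieties over finite fields*, Invent.
  Math. 2 (1966), 134–144, §2, Hyp(k, A, ℓ) (p. 136) and Prop. 1.
* [MilneAV2008] J. S. Milne, *Abelian Varieties* (2008), Ch. IV, Lemma 2.4, Thm. 2.5, Cor. 2.6.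
* [MumfordAV1970] D. Mumford, *Abelian Varieties* (1970), §19 Thm. 1 Cor. 2, Thm. 3.

## Design

Theorems only; `noncomputable section`; universe-monomorphic `K : Type u` (forced by
`AbelianVariety`). The named facts of `FaltingsAbelian` quantify `[NumberField K]` in their bodies
(`∀ [NumberField K], …`); each closed form introduces that instance first (`intro hK`) so that
`CharZero K` / `PerfectField K` are found by instance resolution. `(A ⊞ B) ⊞ (A ⊞ B)` is the point
of `BinaryBiproduct.bicone (A ⊞ B) (A ⊞ B)` definitionally, as in `FaltingsAbelianProofs` :360.
-/

noncomputable section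

universe u

open CategoryTheory CategoryTheory.Limits

namespace Literature.AlgebraicGeometry.Motives

open AbelianVariety

variable {K : Type u} [Field K]

/-! ## Satz 4 (surjectivity half) from the lattice lemma for a bicone point -/

section Surjective

variable {A : AbelianVariety K} (ℓ : ℕ) [Fact ℓ.Prime]

/-- **Satz 4 in span form, from the lattice lemma.** Over a number field, let `b` be a bicone of
`(A, A)` with the total identity (a biproduct `A ⊞ A`); grant Tate's lattice lemma for `b.pt`
(`hW : tateSubspaceRealization b.pt ℓ`) and the semisimplicity of `E_ℓ(A)` (`hss`). Then every
`Γ_K`-equivariant `ℤ_ℓ`-linear endomorphism of `T_ℓ A` lies in the `ℤ_ℓ`-span of the `T_ℓ φ`,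
`φ ∈ End_K(A)`: integral form (`exists_ne_zero_smul_mem_span_of_equivariant_of_tateSubspaceRealization`,
with `T_ℓ A` finitely generated by `module_finite_tateModule_holds_of_charZero`) followed by
`ℓ`-saturation (`mem_span_range_tateModuleMap_of_smul_mem`, `(ℓ : K) ≠ 0` over a number field).
[cite: Faltings1983Endlichkeit, §5 Satz 4] -/
theorem mem_span_of_equivariant_of_tateSubspaceRealization [NumberField K]
    (b : BinaryBicone A A) (hb : b.fst ≫ b.inl + b.snd ≫ b.inr = 𝟙 b.pt)
    (hW : tateSubspaceRealization b.pt ℓ)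
    (hss : IsSemisimpleRing ↥(Algebra.adjoin ℚ_[ℓ] (Set.range fun φ : A ⟶ A ↦
      (rationalTateModuleMap ℓ φ : Module.End ℚ_[ℓ] (A.rationalTateModule ℓ)))))
    (g : Module.End ℤ_[ℓ] (A.tateModule ℓ))
    (hg : ∀ (σ : Field.absoluteGaloisGroup K) (x : A.tateModule ℓ), g (σ • x) = σ • g x) :
    g ∈ Submodule.span ℤ_[ℓ] (Set.range (tateModuleMap ℓ : (A ⟶ A) → _)) := by
  haveI : CharZero K := NumberField.to_charZero
  obtain ⟨N, hN0, hN⟩ :=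
    exists_ne_zero_smul_mem_span_of_equivariant_of_tateSubspaceRealization ℓ b hb hW
      (module_finite_tateModule_holds_of_charZero A ℓ) hss g hg
  exact mem_span_range_tateModuleMap_of_smul_mem ℓ (natCast_ne_zero_of_numberField ℓ) g hN0 hN

/-- **Surjectivity of the Tate map `ℤ_ℓ ⊗ End_K(A) → End_Γ(T_ℓ A)` over a number field, from the
lattice lemma for `b.pt` and the semisimplicity of `E_ℓ(A)`** (Faltings 1983, §5, Satz 4,
surjectivity half): the span form `mem_span_of_equivariant_of_tateSubspaceRealization` and the span
criterion `surjective_faltingsTateMap_of_forall_mem_span`. [cite: Faltings1983Endlichkeit, §5 Satz 4] -/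
theorem surjective_faltingsTateMap_of_tateSubspaceRealization [NumberField K]
    (b : BinaryBicone A A) (hb : b.fst ≫ b.inl + b.snd ≫ b.inr = 𝟙 b.pt)
    (hW : tateSubspaceRealization b.pt ℓ)
    (hss : IsSemisimpleRing ↥(Algebra.adjoin ℚ_[ℓ] (Set.range fun φ : A ⟶ A ↦
      (rationalTateModuleMap ℓ φ : Module.End ℚ_[ℓ] (A.rationalTateModule ℓ))))) :
    Function.Surjective (faltingsTateMap A A ℓ) :=
  surjective_faltingsTateMap_of_forall_mem_span ℓ fun g ↦
    mem_span_of_equivariant_of_tateSubspaceRealization ℓ b hb hW hss g.toLinearMap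
      fun σ x ↦ Representation.IntertwiningMap.isIntertwining _ _ g σ x

end Surjective

/-! ## Satz 4, Korollar 1 and Satz 3 from the lattice lemma alone -/

section Assembly

variable (A B : AbelianVariety K) (ℓ : ℕ) [Fact ℓ.Prime]

/-- **Faltings 1983, §5, Satz 4, from the lattice lemma for `A ⊞ A`, semisimplicity and
injectivity.** For an abelian variety `A` over a field `K` and a prime `ℓ`, grant Tate's lattice
lemma for `A ⊞ A` (`hW`), `E_ℓ(A)` semisimple (`hss`) and injectivity of the Tate map of `End_K(A)`
(`hinj`, the named fact `faltingsTateMap_injective A A`, Mumford §19 Thm. 3). Then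
`faltings_tate_bijective A A ℓ`: over a number field the Tate map `ℤ_ℓ ⊗ End_K(A) → End_Γ(T_ℓ A)` is
bijective (injectivity `hinj` in characteristic `0`; surjectivity
`surjective_faltingsTateMap_of_tateSubspaceRealization` for the biproduct bicone of `(A, A)`).
[cite: Faltings1983Endlichkeit, §5 Satz 4 (proof)] -/
theorem faltings_tate_end_bijective_of_tateSubspaceRealization_of_facts
    (hW : tateSubspaceRealization (A ⊞ A) ℓ)
    (hss : IsSemisimpleRing ↥(Algebra.adjoin ℚ_[ℓ] (Set.range fun φ : A ⟶ A ↦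
      (rationalTateModuleMap ℓ φ : Module.End ℚ_[ℓ] (A.rationalTateModule ℓ)))))
    (hinj : faltingsTateMap_injective A A) :
    faltings_tate_bijective A A ℓ := fun {_} ↦
  ⟨faltingsTateMap_injective_of_numberField A A ℓ hinj,
    surjective_faltingsTateMap_of_tateSubspaceRealization ℓ (BinaryBiproduct.bicone A A) biprod.total
      hW hss⟩

/-- **Faltings 1983, §5, Satz 4, from Tate's lattice lemma for `A ⊞ A` ALONE.** For an abelian
variety `A` over a field `K` and a prime `ℓ`: if every `Γ_K`-stable `ℚ_ℓ`-subspace of `V_ℓ (A ⊞ A)`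
is the image of an element of `ℚ_ℓ · End_K(A ⊞ A)` (`hW : tateSubspaceRealization (A ⊞ A) ℓ`), then
`faltings_tate_bijective A A ℓ` — over a number field the Tate map `ℤ_ℓ ⊗ End_K(A) → End_Γ(T_ℓ A)`
is bijective. The other printed inputs are theorems of the tree: `End⁰(A)` finite-dimensional
(`finiteDimensional_endAlgebra_holds`) and semisimple over the perfect field `K`
(`isSemisimpleRing_endAlgebra_of_perfectField`, Poincaré–Mumford §19 Cor. 2 of Thm. 1 with Galois
descent), whence `E_ℓ(A)` semisimple (`isSemisimpleRing_adjoin_rationalTateModuleMap_of_endAlgebra`);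
and the Tate map injective (`faltingsTateMap_injective_holds`, Mumford §19 Thm. 3).
[cite: Faltings1983Endlichkeit, §5 Satz 4] -/
theorem faltings_tate_end_bijective_of_tateSubspaceRealization
    (hW : tateSubspaceRealization (A ⊞ A) ℓ) : faltings_tate_bijective A A ℓ := by
  intro hK
  exact faltings_tate_end_bijective_of_tateSubspaceRealization_of_facts A ℓ hW
    (isSemisimpleRing_adjoin_rationalTateModuleMap_of_endAlgebra A ℓ
      (finiteDimensional_endAlgebra_holds A) (isSemisimpleRing_endAlgebra_of_perfectField A))
    (faltingsTateMap_injective_holds A A)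

/-- **Faltings 1983, §5, Korollar 1, from Tate's lattice lemma for `(A ⊞ B) ⊞ (A ⊞ B)` ALONE**
("Theorem 4 applied to `A₁ × A₂`"): for abelian varieties `A`, `B` over a field `K` and a prime `ℓ`,
if every `Γ_K`-stable `ℚ_ℓ`-subspace of `V_ℓ ((A ⊞ B) ⊞ (A ⊞ B))` is the image of an element of
`ℚ_ℓ · End_K((A ⊞ B) ⊞ (A ⊞ B))` (`hW`), then `faltings_tate_bijective A B ℓ` — over a number field
the Tate map `ℤ_ℓ ⊗ Hom_K(A, B) → Hom_{Γ_K}(T_ℓ A, T_ℓ B)` is bijective: Satz 4 for `A ⊞ B`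
(`faltings_tate_end_bijective_of_tateSubspaceRealization`) restricted to the corner `Hom(A, B)` of
`End(A ⊞ B)` (`faltings_tate_bijective_of_end_biprod`). Second rung `stub_faltings_of_realization`
of `Cruxes/HLiu418/Lines/faltings_isogeny.lean` (item stmt-HodgeConjecture-24832).
[cite: Faltings1983Endlichkeit, §5 Korollar 1] -/
theorem faltings_tate_bijective_of_tateSubspaceRealization
    (hW : tateSubspaceRealization ((A ⊞ B) ⊞ (A ⊞ B)) ℓ) : faltings_tate_bijective A B ℓ :=
  faltings_tate_bijective_of_end_biprod A B ℓ
    (faltings_tate_end_bijective_of_tateSubspaceRealization (A ⊞ B) ℓ hW)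

/-- **Faltings 1983, §5, Satz 3, from Tate's lattice lemma for `A` ALONE**: if every `Γ_K`-stable
`ℚ_ℓ`-subspace of `V_ℓ A` is the image of an element of `ℚ_ℓ · End_K(A)` (`hW`), then `V_ℓ A` is a
semisimple `ℚ_ℓ[Γ_K]`-module over the number field `K`
(`isSemisimpleRepresentation_rationalTateRep A ℓ`): the idempotent step
`isSemisimpleRepresentation_rationalTateRep_of_tateSubspaceRealization` (`FaltingsAbelianSemisimpleProofs`)
with `E_ℓ(A)` semisimple discharged as in `faltings_tate_end_bijective_of_tateSubspaceRealization`.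
[cite: Faltings1983Endlichkeit, §5 Satz 3] -/
theorem isSemisimpleRepresentation_rationalTateRep_of_tateSubspaceRealization_alone
    (hW : tateSubspaceRealization A ℓ) : isSemisimpleRepresentation_rationalTateRep A ℓ := by
  intro hK
  exact isSemisimpleRepresentation_rationalTateRep_of_tateSubspaceRealization ℓ hW
    (isSemisimpleRing_adjoin_rationalTateModuleMap_of_endAlgebra A ℓ
      (finiteDimensional_endAlgebra_holds A) (isSemisimpleRing_endAlgebra_of_perfectField A))

end Assembly

end Literature.AlgebraicGeometry.Motives
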